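import Summits.NavierStokesRegularity.NavierStokesRegularity.Theorems.ScenarioCensusRowF5lgSlice
import Literature.Analysis.FluidPDE.SwirlCutoff
import Literature.Analysis.FluidPDE.AxisymmetricVorticityTransport
import Literature.Analysis.FluidPDE.ParabolicWeakMaxPointwise
import Literature.Analysis.FluidPDE.KNSSPoloidalAxisDecay
import HarnessLib

/-!
# Tube comparison for the swirl with a TIME-DEPENDENT barrier (the engine behind every one-sided
# radial-inflow criterion with a time-dependent envelope)

Helper toward the crux `AxisymSwirlRegular` (stmt-NavierStokesRegularity-1964, route TypeIIInviscidRelaxation),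
registered line `radial_inflow_split`, criterion side `stub_oneSidedRadialCriterion` (⟨19059⟩).

The tree's comparison engine `ScenarioCensus.LogGate.sign_mul_swirl_le_tube` / `tubeComparison_holds`
(time-INDEPENDENT tube barriers `IsTubeBarrier δ₀ E w`) proves the `C < 2` half of ⟨19059⟩ and the log gate, and
`RadialInflowBarrierWall.not_isTubeBarrier_of_two_le` shows it has no input at `C ≥ 2`.  Every sharper one-sided
criterion in print or in the crux workfiles — Q. S. Zhang 2026 (partial Type I, `u_r ≥ −M(T−t)^{−1/2}`), the
κ-inflow envelopes `u_r ≥ −M r^{κ−1}(T−t)^{−κ/2}` of the ideator line `kappa-inflow` (ns-idea-4) — runs the SAME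
weak-maximum-principle argument with a barrier `w(r,t)` depending on time, the extra term `−A·∂ₜw` being absorbed by
the supersolution clause `w_rr − w_r/r + E·w_r ≤ w_t`.  This file lands that engine once, GENERIC in the envelope
`E(r,t)` and the barrier `(wb, wbt = ∂ₜwb)`:

* `sign_mul_swirl_le_tube_t` — closed slab `[0,T]`, `ν = 1`: classical solution with `|u| ≤ V` and axisymmetric
  slices; barrier slices `C²` on `(0,2)`, jointly continuous and `≥ 0` on `[0,δ₀] × [0,T]` (`δ₀ ≤ 2`), nondecreasing
  in `r`, time derivative `wbt`, supersolution `wb_rr − wb_r/r + E wb_r ≤ wbt` on `(0,δ₀) × (0,T]`; gate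
  `u_r ≥ −E(r,t)` on `0 < r ≤ δ₀`; data `|Γ₀| ≤ A wb(r,0)` (`r ≤ δ₀`) and `|Γ(t)| ≤ A wb(δ₀,t)` on `{r = δ₀}`;
  conclusion `σΓ ≤ A wb(r,t)` on `[0,T] × {r ≤ δ₀}` for `σ = ±1`.

The open-slab corollary (solutions on `[0,T)` bounded on closed sub-slabs, both signs) and the criterion it yields
(Hölder modulus of `Γ` at the axis ⇒ continuation, Lei–Zhang 2017) are in
`TypeIIInviscidRelaxationAxisymSwirlRegularHalfLineBarrierCriterion.lean`.

Ported verbatim (modulo the helpers already in the tree: `radialVelocity_eq_div'`, `horiz_eq_mul_radialVelocity`,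
`horiz_eR`, `SliceCalc.barrier_slice_calculus` of `ScenarioCensusRowF5lgGate/Slice`) from the files-only κ-inflow
skeleton `KappaInflow_v1_9.lean` of the ideator seat ns-idea-4 (section `O2bproof`, 2026-08-28), where it is
kernel-checked but not importable.

References: Qi S. Zhang, *On partial type I solutions to the axially symmetric Navier–Stokes equations*,
arXiv:2604.07785 (2026), §3 pp. 9–10 [Zhang2026PartialTypeI]; G. M. Lieberman, *Second Order Parabolic
Differential Equations*, World Scientific 1996, Ch. II Lemma 2.1 [Lieberman1996].
-/

noncomputable section

set_option linter.dupNamespace false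

open Literature.Analysis.FluidPDE MeasureTheory Set Filter Topology
open scoped ENNReal NNReal RealInnerProductSpace

namespace Summit.NavierStokesRegularity.NavierStokesRegularity.Theorems.RadialInflowComparisonT

open Summit.NavierStokesRegularity.NavierStokesRegularity.Theorems
open Summit.NavierStokesRegularity.NavierStokesRegularity.Theorems.ScenarioCensus
open Summit.NavierStokesRegularity.NavierStokesRegularity.Theorems.ScenarioCensus.LogGate
open Metric Function InnerProductSpace
open scoped Laplacian ContDiff

set_option maxHeartbeats 400000 in
/-- **One-sided tube comparison on a closed slab, time-dependent barrier** (the heart of O2b; Q. S. Zhang,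
arXiv:2604.07785 §3 pp. 9–10; template = the tree's `sign_mul_swirl_le_of_classical_of_nonneg`, `SwirlMaximumPrinciple`).
For a classical solution at `ν = 1` on `[0,T] × ℝ³` with `|u| ≤ V` and axisymmetric slices, a profile `wb(r,t)` whose
`r`-slices are `C²` on `(0,2)` for `t ∈ (0,T]`, jointly continuous on `[0,δ₀] × [0,T]` (`δ₀ ≤ 2`), `≥ 0` there, with a
time derivative `wbt(r,t)` on `(0,δ₀) × (0,T]`, nondecreasing in `r`, and a supersolution
`wb_rr − wb_r/r + E wb_r ≤ wbt` on `(0,δ₀) × (0,T]`; the gate `u_r ≥ −E(r,t)` on `0 < r ≤ δ₀`; and the boundary data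
`|Γ₀| ≤ A wb(r,0)` (`r ≤ δ₀`), `|Γ(t)| ≤ A wb(δ₀,t)` on `{r = δ₀}`: for a sign `σ = ±1`, `σΓ(t,x) ≤ A wb(r,t)` on
`[0,T] × {r ≤ δ₀}`. PROOF: `weak_max_principle_of_contDiffAt` for `w = σΓ − A wb(r,t) − ε e^{βt}(1+|x|²)`, `β = 7 + V`,
on `K = closedBall 0 R ∩ {r ≤ δ₀}`, `U = ball 0 R ∩ {0 < r < δ₀}`, `R ≥ 2V/ε`; at an interior critical point
`σ∇Γ = A wb_r r⁻¹(x₀,x₁,0)·· + 2c x`, `σΔΓ ≤ A(wb_rr + wb_r/r) + 6c`, and the swirl equation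
`Γ_t = ΔΓ − (2/r)∂_rΓ − u·∇Γ` (`swirl_transport_holds`) gives
`σΓ_t ≤ A(wb_rr − wb_r/r − u_r wb_r) + 6c + 2c|x|V ≤ A wbt + (6+V)c(1+|x|²)`, so `w_t = σΓ_t − A wbt − βc(1+|x|²) < 0`;
parabolic boundary: `t = 0` (data), axis (`Γ = 0 ≤ A wb`), `{r = δ₀}` (data), sphere (`|Γ| ≤ 2RV ≤ ε(1+R²)`); then
`ε → 0`. [cite: Zhang2026PartialTypeI, §3] [cite: Lieberman1996, Ch. II Lemma 2.1] -/
theorem sign_mul_swirl_le_tube_t {T V δ₀ A : ℝ} {E wb wbt : ℝ → ℝ → ℝ} {u : ℝ → E3 → E3} {p : ℝ → E3 → ℝ}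
    (hT : 0 < T) (hA : 0 ≤ A) (hδ2 : δ₀ ≤ 2)
    (hcl : IsClassicalNSSolutionOn (Icc 0 T) 1 0 u p)
    (haxi : ∀ t ∈ Icc 0 T, IsAxisymmetric (u t)) (hV : ∀ t ∈ Icc 0 T, ∀ x, ‖u t x‖ ≤ V)
    (hC2 : ∀ t ∈ Ioc 0 T, ContDiffOn ℝ 2 (fun ρ => wb ρ t) (Ioo 0 2))
    (hC0 : ContinuousOn (fun q : ℝ × ℝ => wb q.1 q.2) (Icc 0 δ₀ ×ˢ Icc 0 T))
    (hwt : ∀ t ∈ Ioc 0 T, ∀ r ∈ Ioo 0 δ₀, HasDerivAt (fun s => wb r s) (wbt r t) t)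
    (hwnn : ∀ t ∈ Icc 0 T, ∀ r ∈ Icc 0 δ₀, 0 ≤ wb r t)
    (hmono : ∀ t ∈ Ioc 0 T, ∀ r ∈ Ioo 0 δ₀, 0 ≤ deriv (fun ρ => wb ρ t) r)
    (hop : ∀ t ∈ Ioc 0 T, ∀ r ∈ Ioo 0 δ₀,
      iteratedDeriv 2 (fun ρ => wb ρ t) r - r⁻¹ * deriv (fun ρ => wb ρ t) r
        + E r t * deriv (fun ρ => wb ρ t) r ≤ wbt r t)
    (hgate : ∀ t ∈ Icc 0 T, ∀ x : E3, 0 < cylRadius x → cylRadius x ≤ δ₀ →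
      -E (cylRadius x) t ≤ radialVelocity (u t) x)
    (hdat : ∀ x : E3, cylRadius x ≤ δ₀ → |swirl (u 0) x| ≤ A * wb (cylRadius x) 0)
    (hlatδ : ∀ t ∈ Icc 0 T, ∀ x : E3, cylRadius x = δ₀ → |swirl (u t) x| ≤ A * wb δ₀ t)
    {σ : ℝ} (hσ : σ = 1 ∨ σ = -1) :
    ∀ t ∈ Icc 0 T, ∀ x : E3, cylRadius x ≤ δ₀ → σ * swirl (u t) x ≤ A * wb (cylRadius x) t := by
  have hV0 : 0 ≤ V := (norm_nonneg _).trans (hV 0 ⟨le_rfl, hT.le⟩ 0)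
  have hσabs : ∀ a : ℝ, σ * a ≤ |a| := fun a => by
    rcases hσ with h | h
    · rw [h, one_mul]; exact le_abs_self a
    · rw [h, neg_one_mul]; exact neg_le_abs a
  -- the pressure is axisymmetric, so the swirl equation holds off the axis
  have hp : ∀ t ∈ Icc 0 T, IsAxisymmetricScalar (p t) := fun t ht =>
    hcl.isAxisymmetricScalar_pressure (uniqueDiffOn_Icc hT) haxi (fun _ _ => isAxisymmetric_zero) ht
  -- constants of the corrector (`ν = 1`)
  set β : ℝ := 6 + V + 1 with hβ
  have hβ0 : 0 ≤ β := by rw [hβ]; positivity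
  -- the claim for every `ε > 0`, on every large truncated tube
  suffices key : ∀ ε : ℝ, 0 < ε → ∀ R : ℝ, 2 * V / ε ≤ R →
      ∀ t ∈ Icc 0 T, ∀ x ∈ closedBall (0 : E3) R ∩ {x : E3 | cylRadius x ≤ δ₀},
        σ * swirl (u t) x - A * wb (cylRadius x) t - ε * Real.exp (β * t) * (1 + ‖x‖ ^ 2) ≤ 0 by
    intro t ht x hxδ
    refine le_of_forall_pos_le_add fun η hη => ?_
    set C : ℝ := Real.exp (β * t) * (1 + ‖x‖ ^ 2) with hC
    have hCpos : 0 < C := by positivity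
    have h := key (η / C) (div_pos hη hCpos) (max (2 * V / (η / C)) ‖x‖) (le_max_left _ _) t ht x
      ⟨mem_closedBall_zero_iff.2 (le_max_right _ _), hxδ⟩
    have e : η / C * Real.exp (β * t) * (1 + ‖x‖ ^ 2) = η := by
      rw [hC]; field_simp
    rw [e] at h
    linarith
  intro ε hε R hR
  have hR0 : 0 ≤ R := le_trans (by positivity) hR
  -- the comparison function
  set w : ℝ → E3 → ℝ := fun t x =>
    σ * swirl (u t) x - A * wb (cylRadius x) t - ε * Real.exp (β * t) * (1 + ‖x‖ ^ 2) with hw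
  set Γₜ : ℝ → E3 → ℝ := fun t x => timeDerivWithin (Icc 0 T) (fun s => swirl (u s)) t x with hΓₜ
  set wₜ : ℝ → E3 → ℝ := fun t x =>
    σ * Γₜ t x - A * wbt (cylRadius x) t - β * (ε * Real.exp (β * t) * (1 + ‖x‖ ^ 2)) with hwₜ
  set K : Set E3 := closedBall 0 R ∩ {x : E3 | cylRadius x ≤ δ₀} with hK
  set U : Set E3 := ball 0 R ∩ cylRadius ⁻¹' Ioo 0 δ₀ with hU
  have hKc : IsCompact K :=
    (isCompact_closedBall _ _).inter_right (isClosed_le continuous_cylRadius continuous_const)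
  have hUo : IsOpen U := isOpen_ball.inter (isOpen_Ioo.preimage continuous_cylRadius)
  have hUK : U ⊆ K := fun x hx => ⟨ball_subset_closedBall hx.1, le_of_lt hx.2.2⟩
  -- regularity of the velocity
  have hsm := hcl.smooth_velocity
  have hvC2 : ∀ t ∈ Icc 0 T, ContDiff ℝ 2 (u t) := fun t ht =>
    (hcl.contDiff_velocity ht).of_le (by norm_cast)
  have hvd : ∀ t ∈ Icc 0 T, ∀ x, DifferentiableAt ℝ (u t) x := fun t ht x =>
    ((hvC2 t ht).of_le one_le_two).differentiable one_ne_zero x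
  -- (a) joint continuity
  have hc : ContinuousOn (uncurry w) (Icc 0 T ×ˢ K) := by
    have hvc : ContinuousOn (uncurry u) (Icc 0 T ×ˢ K) :=
      hsm.continuousOn.mono (prod_mono Subset.rfl (subset_univ _))
    have h1 : ContinuousOn (fun q : ℝ × E3 => ⟪rotGenL q.2, uncurry u q⟫) (Icc 0 T ×ˢ K) :=
      (rotGenL.continuous.comp continuous_snd).continuousOn.inner hvc
    have hm : Continuous fun q : ℝ × E3 => (cylRadius q.2, q.1) :=
      (continuous_cylRadius.comp continuous_snd).prodMk continuous_fst
    have h2' : ContinuousOn ((fun q : ℝ × ℝ => wb q.1 q.2) ∘ fun q : ℝ × E3 => (cylRadius q.2, q.1))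
        (Icc 0 T ×ˢ K) :=
      hC0.comp hm.continuousOn fun q hq => ⟨⟨cylRadius_nonneg _, hq.2.2⟩, hq.1⟩
    have h2 : ContinuousOn (fun q : ℝ × E3 => A * wb (cylRadius q.2) q.1) (Icc 0 T ×ˢ K) :=
      continuousOn_const.mul h2'
    have h3 : Continuous fun q : ℝ × E3 => ε * Real.exp (β * q.1) * (1 + ‖q.2‖ ^ 2) := by
      fun_prop
    refine ((((continuousOn_const (c := σ)).mul h1).sub h2).sub h3.continuousOn).congr fun q _ => ?_
    simp only [hw, uncurry, rotGenL_apply, swirl_eq_inner_rotGen, Pi.sub_apply, Pi.mul_apply]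
  -- (b) `C²` slices at the points of `U`
  have h2 : ∀ t ∈ Ioc 0 T, ∀ x ∈ U, ContDiffAt ℝ 2 (w t) x := by
    intro t ht x hx
    have htI : t ∈ Icc 0 T := ⟨ht.1.le, ht.2⟩
    have hsl : ContDiffAt ℝ 2 (fun y : E3 => wb (cylRadius y) t) x :=
      (SliceCalc.barrier_slice_calculus (hC2 t ht) hx.2.1 (hx.2.2.trans_le hδ2)).1
    have h1 : ContDiffAt ℝ 2 (fun y => σ * swirl (u t) y) x :=
      (contDiff_const.mul (contDiff_swirl (hvC2 t htI))).contDiffAt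
    have h3 : ContDiffAt ℝ 2 (fun y : E3 => ε * Real.exp (β * t) * (1 + ‖y‖ ^ 2)) x :=
      (contDiff_const.mul (contDiff_const.add (contDiff_norm_sq ℝ))).contDiffAt
    exact (h1.sub (contDiffAt_const.mul hsl)).sub h3
  -- (c) the left time derivative
  have ht : ∀ t ∈ Ioc 0 T, ∀ x ∈ U, HasDerivWithinAt (fun s => w s x) (wₜ t x) (Icc 0 t) t := by
    intro t ht x hx
    have htI : t ∈ Icc 0 T := ⟨ht.1.le, ht.2⟩
    have hΓ : HasDerivWithinAt (fun s => swirl (u s) x) (Γₜ t x) (Icc 0 T) t := by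
      have hd : DifferentiableWithinAt ℝ (fun s => swirl (u s) x) (Icc 0 T) t := by
        have h1 := hsm.differentiableWithinAt_time htI x
        simp only [swirl_eq_inner_rotGen]
        exact (differentiableWithinAt_const _).inner ℝ h1
      have := hd.hasDerivWithinAt
      simp only [hΓₜ, timeDerivWithin_apply]
      exact this
    have hW : HasDerivWithinAt (fun s => A * wb (cylRadius x) s) (A * wbt (cylRadius x) t) (Icc 0 T) t :=
      ((hwt t ht (cylRadius x) hx.2).hasDerivWithinAt).const_mul A
    have hexp : HasDerivWithinAt (fun s => ε * Real.exp (β * s) * (1 + ‖x‖ ^ 2))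
        (ε * (Real.exp (β * t) * β) * (1 + ‖x‖ ^ 2)) (Icc 0 T) t := by
      have h1 : HasDerivAt (fun s => Real.exp (β * s)) (Real.exp (β * t) * β) t := by
        have := ((hasDerivAt_id t).const_mul β).exp
        simpa using this
      exact ((h1.const_mul ε).mul_const (1 + ‖x‖ ^ 2)).hasDerivWithinAt
    have h := (((hΓ.const_mul σ).sub hW).sub hexp).mono (Icc_subset_Icc_right ht.2)
    simp only [hw, hwₜ]
    exact h.congr_deriv (by ring)
  -- (d) the sub-solution implication, from the swirl equation and the supersolution property of `wb`
  have hsub : ∀ t ∈ Ioc 0 T, ∀ x ∈ U, fderiv ℝ (w t) x = 0 → (Δ (w t)) x ≤ 0 → wₜ t x ≤ 0 := by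
    intro t ht x hx hgrad hlap
    have htI : t ∈ Icc 0 T := ⟨ht.1.le, ht.2⟩
    have hr0 : 0 < cylRadius x := hx.2.1
    have hrδ : cylRadius x < δ₀ := hx.2.2
    have hr : cylRadius x ≠ 0 := hr0.ne'
    have hur : -E (cylRadius x) t ≤ radialVelocity (u t) x := hgate t htI x hr0 hrδ.le
    -- slice calculus of the barrier at `x`, the swirl equation at `(t, x)`
    obtain ⟨hslC2, hslD, hslΔ⟩ := SliceCalc.barrier_slice_calculus (hC2 t ht) hr0 (hrδ.trans_le hδ2)
    have hslC2' : ContDiffAt ℝ 2 (fun y : E3 => wb (cylRadius y) t) x := hslC2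
    have hslD' : ∀ a : E3, fderiv ℝ (fun y : E3 => wb (cylRadius y) t) x a =
        deriv (fun ρ => wb ρ t) (cylRadius x) * (cylRadius x)⁻¹ * (x 0 * a 0 + x 1 * a 1) := hslD
    have hslΔ' : (Δ (fun y : E3 => wb (cylRadius y) t)) x =
        iteratedDeriv 2 (fun ρ => wb ρ t) (cylRadius x) + (cylRadius x)⁻¹ * deriv (fun ρ => wb ρ t) (cylRadius x) :=
      hslΔ
    have hpde := swirl_transport_holds hcl haxi hp htI hr
    have hf0 : swirl ((0 : ℝ → E3 → E3) t) x = 0 := by simp [swirl]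
    rw [hf0, add_zero, convect_apply, partialDeriv_apply] at hpde
    have hxeR := horiz_eR hr
    have hxu := horiz_eq_mul_radialVelocity (u t) hr
    set c : ℝ := ε * Real.exp (β * t) with hc
    have hc0 : 0 < c := by positivity
    have hopr := hop t ht (cylRadius x) ⟨hr0, hrδ⟩
    have hwb1nn := hmono t ht (cylRadius x) ⟨hr0, hrδ⟩
    set r : ℝ := cylRadius x with hrdef
    set wb1 : ℝ := deriv (fun ρ => wb ρ t) r with hwb1
    set wb2 : ℝ := iteratedDeriv 2 (fun ρ => wb ρ t) r with hwb2
    set ur : ℝ := radialVelocity (u t) x with hur'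
    -- derivatives of the three parts of `w t`
    have hΓd : DifferentiableAt ℝ (swirl (u t)) x := differentiableAt_swirl (hvd t htI x)
    have hB : HasFDerivAt (fun y : E3 => c * (1 + ‖y‖ ^ 2))
        (c • ((2 : ℕ) • (innerSL ℝ x : E3 →L[ℝ] ℝ))) x :=
      (((hasStrictFDerivAt_norm_sq x).hasFDerivAt).const_add 1).const_mul c
    have hWd : HasFDerivAt (fun y : E3 => A * wb (cylRadius y) t)
        (A • fderiv ℝ (fun y : E3 => wb (cylRadius y) t) x) x :=
      (hslC2'.differentiableAt (by simp)).hasFDerivAt.const_mul A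
    have hwderiv : HasFDerivAt (w t) (σ • fderiv ℝ (swirl (u t)) x -
        A • fderiv ℝ (fun y : E3 => wb (cylRadius y) t) x -
        c • ((2 : ℕ) • (innerSL ℝ x : E3 →L[ℝ] ℝ))) x := by
      have h := ((hΓd.hasFDerivAt.const_mul σ).sub hWd).sub hB
      simp only [hw, hc] at h ⊢
      exact h
    have hDeq : σ • fderiv ℝ (swirl (u t)) x =
        A • fderiv ℝ (fun y : E3 => wb (cylRadius y) t) x + c • ((2 : ℕ) • (innerSL ℝ x : E3 →L[ℝ] ℝ)) := by
      have h' := (hwderiv.fderiv).symm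
      rw [hgrad, sub_sub, sub_eq_zero] at h'
      exact h'
    have hDapply : ∀ a : E3, σ * fderiv ℝ (swirl (u t)) x a =
        A * (wb1 * r⁻¹ * (x 0 * a 0 + x 1 * a 1)) + c * (2 * ⟪x, a⟫) := fun a => by
      have := congrArg (fun L : E3 →L[ℝ] ℝ => L a) hDeq
      simp only [_root_.add_apply, _root_.smul_apply] at this
      simp only [smul_eq_mul, nsmul_eq_mul, Nat.cast_ofNat, innerSL_apply_apply, hslD' a] at this
      linarith
    -- Laplacian of `w t` at `x`
    have hΔeq : (Δ (w t)) x = σ * (Δ (swirl (u t))) x - A * (wb2 + r⁻¹ * wb1) - 6 * c := by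
      have h1 : ContDiffAt ℝ 2 (fun y => σ * swirl (u t) y) x :=
        (contDiff_const.mul (contDiff_swirl (hvC2 t htI))).contDiffAt
      have h2w : ContDiffAt ℝ 2 (fun y : E3 => A * wb (cylRadius y) t) x := contDiffAt_const.mul hslC2'
      have h3 : ContDiffAt ℝ 2 (fun y : E3 => (c * (1 + ‖y‖ ^ 2) : ℝ)) x :=
        (contDiff_const.mul (contDiff_const.add (contDiff_norm_sq ℝ))).contDiffAt
      have e1 : (Δ (fun y => σ * swirl (u t) y)) x = σ * (Δ (swirl (u t))) x := by
        have : (fun y => σ * swirl (u t) y) = σ • swirl (u t) := by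
          funext y; simp [smul_eq_mul]
        rw [this, laplacian_smul σ ((contDiff_swirl (hvC2 t htI)).contDiffAt), smul_eq_mul]
      have e2 : (Δ (fun y : E3 => A * wb (cylRadius y) t)) x = A * (wb2 + r⁻¹ * wb1) := by
        have : (fun y : E3 => A * wb (cylRadius y) t) = A • fun y : E3 => wb (cylRadius y) t := by
          funext y; simp [smul_eq_mul]
        rw [this, laplacian_smul A hslC2', smul_eq_mul, hslΔ']
      have e3 : (Δ (fun y : E3 => (c * (1 + ‖y‖ ^ 2) : ℝ))) x = 6 * c := by
        rw [show (fun y : E3 => (c * (1 + ‖y‖ ^ 2) : ℝ)) = fun y => (0 + c * (1 + ‖y‖ ^ 2) : ℝ) from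
          funext fun y => by ring]
        exact laplacian_barrier 0 c x
      have h12 : ContDiffAt ℝ 2 ((fun y => σ * swirl (u t) y) - fun y : E3 => A * wb (cylRadius y) t) x :=
        h1.sub h2w
      have hfun : w t = ((fun y => σ * swirl (u t) y) - fun y : E3 => A * wb (cylRadius y) t) -
          fun y : E3 => (c * (1 + ‖y‖ ^ 2) : ℝ) := by
        funext y
        simp only [hw, hc, Pi.sub_apply]
      rw [hfun, h12.laplacian_sub h3, h1.laplacian_sub h2w, e1, e2, e3]
    have hΔ : σ * (Δ (swirl (u t))) x ≤ A * (wb2 + r⁻¹ * wb1) + 6 * c := by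
      rw [hΔeq] at hlap; linarith
    -- the first-order terms at the critical point
    have heR : σ * fderiv ℝ (swirl (u t)) x (eR x) = A * wb1 + c * (2 * ⟪x, eR x⟫) := by
      rw [hDapply (eR x), hxeR, inv_mul_cancel_right₀ hr]
    have hcv : σ * fderiv ℝ (swirl (u t)) x (u t x) = A * (wb1 * ur) + c * (2 * ⟪x, u t x⟫) := by
      have e : wb1 * r⁻¹ * (r * ur) = wb1 * ur := by rw [← mul_assoc, inv_mul_cancel_right₀ hr]
      rw [hDapply (u t x), hxu, e]
    have hrad : 0 ≤ ⟪x, eR x⟫ := inner_self_eR_nonneg x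
    have hconv : -(c * (2 * ⟪x, u t x⟫)) ≤ c * (2 * (‖x‖ * V)) := by
      have h1 : |⟪x, u t x⟫| ≤ ‖x‖ * ‖u t x‖ := abs_real_inner_le_norm _ _
      have h2 : ‖x‖ * ‖u t x‖ ≤ ‖x‖ * V := mul_le_mul_of_nonneg_left (hV t htI x) (norm_nonneg _)
      have h3 := (abs_le.1 (h1.trans h2)).1
      have h4 := mul_le_mul_of_nonneg_left h3 hc0.le
      linarith
    -- `σ Γₜ ≤ A·(wb_rr − wb_r/r + E wb_r) + 6c + 2c|x|V ≤ A wbt + 6c + 2c|x|V`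
    have hΓeq : Γₜ t x = ((Δ (swirl (u t))) x - 2 / r * fderiv ℝ (swirl (u t)) x (eR x)) -
        fderiv ℝ (swirl (u t)) x (u t x) := by
      have := eq_sub_of_add_eq hpde
      simpa [hΓₜ] using this
    have hΓt : σ * Γₜ t x ≤ A * wbt r t + 6 * c + c * (2 * (‖x‖ * V)) := by
      have e : σ * Γₜ t x = σ * (Δ (swirl (u t))) x - 2 * r⁻¹ * (σ * fderiv ℝ (swirl (u t)) x (eR x)) -
          σ * fderiv ℝ (swirl (u t)) x (u t x) := by
        rw [hΓeq, div_eq_mul_inv]; ring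
      rw [e, heR, hcv]
      have h1 : 0 ≤ 2 * r⁻¹ * (c * (2 * ⟪x, eR x⟫)) :=
        mul_nonneg (mul_nonneg zero_le_two (inv_nonneg.2 hr0.le))
          (mul_nonneg hc0.le (mul_nonneg zero_le_two hrad))
      have h2 : A * (wb1 * -ur) ≤ A * (wb1 * E r t) :=
        mul_le_mul_of_nonneg_left (mul_le_mul_of_nonneg_left (by linarith) hwb1nn) hA
      have h3 : A * (wb2 - r⁻¹ * wb1 + E r t * wb1) ≤ A * wbt r t := mul_le_mul_of_nonneg_left hopr hA
      have e2 : A * (wb1 * -ur) = -(A * (wb1 * ur)) := by ring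
      have e3 : A * (wb2 - r⁻¹ * wb1 + E r t * wb1) =
          A * (wb2 + r⁻¹ * wb1) - 2 * r⁻¹ * (A * wb1) + A * (wb1 * E r t) := by ring
      linarith
    -- conclude: `wₜ ≤ (6 + V − β) c (1 + |x|²) ≤ 0`
    set D : ℝ := c * (1 + ‖x‖ ^ 2) with hD
    have hD0 : 0 ≤ D := by positivity
    have hx2 : 2 * (‖x‖ * V) ≤ V * (1 + ‖x‖ ^ 2) := by
      have h := mul_nonneg hV0 (sq_nonneg (‖x‖ - 1))
      have e : V * (1 + ‖x‖ ^ 2) - 2 * (‖x‖ * V) = V * (‖x‖ - 1) ^ 2 := by ring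
      linarith
    have hx2' : c * (2 * (‖x‖ * V)) ≤ V * D := by
      calc c * (2 * (‖x‖ * V)) ≤ c * (V * (1 + ‖x‖ ^ 2)) := mul_le_mul_of_nonneg_left hx2 hc0.le
        _ = V * D := by rw [hD]; ring
    have h6 : 6 * c ≤ 6 * D := by
      have hpos : 0 ≤ c * ‖x‖ ^ 2 := by positivity
      have e : 6 * D - 6 * c = 6 * (c * ‖x‖ ^ 2) := by rw [hD]; ring
      linarith
    have e2 : β * D = (6 + V) * D + D := by rw [hβ]; ring
    have e3 : wₜ t x = σ * Γₜ t x - A * wbt r t - β * D := by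
      simp only [hwₜ, hD, hc, hrdef]
    rw [e3]
    linarith
  -- (e) the parabolic boundary: `t = 0`
  have hbot : ∀ x ∈ K, w 0 x ≤ 0 := by
    intro x hx
    simp only [hw, mul_zero, Real.exp_zero, mul_one]
    have h1 := hσabs (swirl (u 0) x)
    have h2 := hdat x hx.2
    have h3 : 0 ≤ ε * (1 + ‖x‖ ^ 2) := by positivity
    linarith
  -- (f) the parabolic boundary: the axis, the cylinder `r = δ₀` and the sphere `|x| = R`
  have hlat : ∀ t ∈ Icc 0 T, ∀ x ∈ K \ U, w t x ≤ 0 := by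
    intro t ht x hx
    have hexp1 : 1 ≤ Real.exp (β * t) := Real.one_le_exp (mul_nonneg hβ0 ht.1)
    have hH : ε * (1 + ‖x‖ ^ 2) ≤ ε * Real.exp (β * t) * (1 + ‖x‖ ^ 2) := by
      have : ε * (1 + ‖x‖ ^ 2) * 1 ≤ ε * (1 + ‖x‖ ^ 2) * Real.exp (β * t) :=
        mul_le_mul_of_nonneg_left hexp1 (by positivity)
      linarith
    have hxK : ‖x‖ ≤ R := mem_closedBall_zero_iff.1 hx.1.1
    have hxδ : cylRadius x ≤ δ₀ := hx.1.2
    have hwbx : 0 ≤ A * wb (cylRadius x) t := mul_nonneg hA (hwnn t ht _ ⟨cylRadius_nonneg x, hxδ⟩)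
    have hcorr : 0 ≤ ε * Real.exp (β * t) * (1 + ‖x‖ ^ 2) := by positivity
    simp only [hw]
    by_cases hax : cylRadius x = 0
    · -- on the axis the swirl vanishes
      rw [swirl_eq_zero_of_cylRadius_eq_zero (u t) hax, mul_zero]
      linarith
    · by_cases hxe : cylRadius x = δ₀
      · -- on the cylinder `r = δ₀`: `σΓ ≤ |Γ| ≤ A wb(δ₀,t)`
        have h1 := hσabs (swirl (u t) x)
        have h2 := hlatδ t ht x hxe
        rw [hxe]
        linarith
      · -- on the sphere `|x| = R ≥ 2V/ε`
        have hrI : cylRadius x ∈ Ioo 0 δ₀ :=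
          ⟨lt_of_le_of_ne (cylRadius_nonneg x) (Ne.symm hax), lt_of_le_of_ne hxδ hxe⟩
        have hxR : ‖x‖ = R := by
          have hnot : x ∉ ball (0 : E3) R := fun hb => hx.2 ⟨hb, hrI⟩
          have : R ≤ ‖x‖ := by simpa using hnot
          exact le_antisymm hxK this
        have h1 : σ * swirl (u t) x ≤ 2 * R * V := by
          refine (hσabs _).trans ?_
          calc |swirl (u t) x| ≤ 2 * ‖x‖ * ‖u t x‖ := abs_swirl_le_norm_mul (u t) x
            _ ≤ 2 * R * V := by
              rw [hxR]
              exact mul_le_mul_of_nonneg_left (hV t ht x) (by positivity)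
        have h2 : 2 * R * V ≤ ε * (1 + ‖x‖ ^ 2) := by
          rw [hxR]
          have h3 : 2 * V ≤ ε * R := by
            rw [div_le_iff₀ hε] at hR; linarith
          have h4 := mul_le_mul_of_nonneg_left h3 hR0
          have h5 : 0 ≤ ε := hε.le
          have e : ε * (1 + R ^ 2) = ε + R * (ε * R) := by ring
          rw [e]
          linarith
        linarith
  exact weak_max_principle_of_contDiffAt hKc hUo hUK hc h2 ht hsub hbot hlat

end Summit.NavierStokesRegularity.NavierStokesRegularity.Theorems.RadialInflowComparisonT

end
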